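import Mathlib.Analysis.Complex.Basic
import HarnessLib

/-!
# Weil 1965: the Siegel–Weil formula in the convergent case (typed skeleton of Théorème 5)

A. Weil, *Sur la formule de Siegel dans la théorie des groupes classiques*, Acta Math. 113 (1965) 1–87
[Weil1965], Chap. VI "La formule de Siegel", n° 51–52 (pp. 75–77).  WHAT IS REPRODUCED: the STATEMENT of
Théorème 5 (n° 52) — for an algebra with involution `𝒜_k` of type (I) over a number field `k` and a left
`𝒜_k`-module `X_k` satisfying Weil's condition (B) `m > 2n + 4ε − 2`, under a place/measure hypothesis, the theta
integral `I_ν(Φ) = ∫_{G_A/G_k} Σ_{ξ ∈ X_k} Φ(ρ(u)ξ) dν(u)` equals the Eisenstein–Siegel series `E(Φ)` for every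
Schwartz–Bruhat function `Φ` — as a TYPED SKELETON: a predicate `def WeilSiegelWeil (D : SiegelWeilDatum SX) : Prop`
over a hypothesis structure of BARE FUNCTIONS on the parameter type `SX = S(X_A)` (`Φ ↦ I_ν(Φ)`, `Φ ↦ E(Φ)`, the
integers `m`, `n`, `4ε`, and the place/measure hypothesis as a bare `Prop`); NOTHING IS ASSERTED.  Quotations AS
PRINTED were read on the held OCR text (corpus key `paper:weil1965-sur-la-formule-de-siegel-dans-la`, PDF chunks
p0066, p0089–p0091; accents restored).

NOT here: the objects themselves (`𝒜_k`, `X_k`, the unitary group `G`, `Mp`/`Ps(X_A)`, the measures), the second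
assertion (41) of Théorème 5, conditions (A)/(B′), Théorème 1 (convergence of `E(Φ)`), the proofs (n° 52–53).

## References

* [Weil1965] A. Weil, *Sur la formule de Siegel dans la théorie des groupes classiques*, Acta Math. 113 (1965)
  1–87, doi:10.1007/BF02391774 — n° 38 p. 55 (condition (B)), n° 51 Prop. 8 p. 75, n° 52 Théorème 5 pp. 76–77.
-/

namespace Literature.NumberTheory.Weil1965

universe u

/-- **Carriers for Weil's Siegel formula** [Weil1965, Chap. VI, n° 51–52, pp. 75–77]: `𝒜_k` an algebra with
involution of type (I) over a number field `k` (`m` its dimension parameter, `ε` Weil's invariant of the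
involution — `ε = ½`, so `4ε = 2`, in the hermitian case), `X_k` a left `𝒜_k`-module of rank `n`, `G` the unitary
group of `𝒜`, `SX = S(X_A)` the Schwartz–Bruhat space (a parameter type); the datum records
* `thetaInt Φ = I_ν(Φ) = ∫_{G_A/G_k} Σ_{ξ ∈ X_k} Φ(ρ(u)ξ) dν(u)`;
* `eis Φ = E(Φ)`, the Eisenstein–Siegel series (30) of n° 39 (absolutely convergent for every `Φ` iff condition
  (A), Théorème 1, p. 57; (B) ⇒ (A));
* `m`, `n`, `fourEps = 4ε`;
* `placeHyp` — "`v` une place de `k` telle que `U(0)_v` ne soit pas vide, et `G'_v` un sous-groupe de `G_v` qui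
  opère transitivement sur `U(i)_v` quel que soit `i ∈ I(X)_k` … `ν` une mesure positive sur `G_A/G_k`, invariante
  par `G'_v`, telle que `ν(G_A/G_k) = 1` et que l'intégrale `I_ν(Φ)` soit absolument convergente quelle que soit
  `Φ ∈ S(X_A)`" (a bare `Prop`: the user proves it for its datum).
A hypothesis structure: nothing is asserted. [cite: Weil1965, Chap. VI n° 51–52, pp. 75–77] -/
structure SiegelWeilDatum (SX : Type u) where
  /-- `Φ ↦ I_ν(Φ)` -/
  thetaInt : SX → ℂ
  /-- `Φ ↦ E(Φ)` -/
  eis : SX → ℂ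
  /-- `m` -/
  m : ℕ
  /-- `n = rank X_k` -/
  n : ℕ
  /-- `4ε` -/
  fourEps : ℕ
  /-- the place / measure hypothesis of Théorème 5 -/
  placeHyp : Prop

namespace SiegelWeilDatum

variable {SX : Type u}

/-- **Weil's Siegel–Weil formula (convergent case).**  AS PRINTED [Weil1965, Théorème 5, n° 52, pp. 76–77
(PDF p0090 L31 – p0091 L10)]: "Soient `𝒜_k` une algèbre de type (I) et `X_k` un `𝒜_k`-module à gauche,
satisfaisant à (B) c'est-à-dire à `m > 2n + 4ε − 2`.  Soient `v` une place de `k` telle que `U(0)_v` ne soit pas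
vide, et `G'_v` un sous-groupe de `G_v` qui opère transitivement sur `U(i)_v` quel que soit `i ∈ I(X)_k`.  Soit
`ν` une mesure positive sur `G_A/G_k`, invariante par `G'_v`, telle que `ν(G_A/G_k) = 1` et que l'intégrale
`I_ν(Φ) = ∫_{G_A/G_k} Σ_{ξ∈X_k} Φ(ρ(u)ξ) dν(u)` soit absolument convergente quelle que soit `Φ ∈ S(X_A)`.  Alors
on a `I_ν(Φ) = E(Φ)`, et, pour tout `i ∈ I(X)_k`: [formula (41)] … Ces résultats … sont valables en particulier
quand on prend pour `ν` la mesure de Haar sur `G` normée par `ν(G_A/G_k) = 1`."  Condition (B): [Weil1965,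
n° 38, p. 55 (p0066 L2)] "`𝒜` et `X` satisfont à la condition (B) si `m > 2n + 4ε − 2` dans le cas (I)";
convergence of `I(Φ)`: [Weil1965, Prop. 8, n° 51, p. 75 (p0089 L33–34)] "l'intégrale `I(Φ)` est absolument
convergente, quelle que soit `Φ ∈ S(X_A)`, chaque fois que `r = 0` ou que `m − r > n + 2ε − 1`".
TYPING: (B) is the arithmetic antecedent `2n + 4ε < m + 2`; the place/measure hypothesis is the bare `placeHyp`;
conclusion = the first assertion `I_ν(Φ) = E(Φ)` only ((41) is not typed).  Never stronger than print.
[cite: Weil1965, Théorème 5 (n° 52), pp. 76–77] -/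
def WeilSiegelWeil (D : SiegelWeilDatum SX) : Prop :=
  2 * D.n + D.fourEps < D.m + 2 → D.placeHyp → ∀ Φ : SX, D.thetaInt Φ = D.eis Φ

/-- The hermitian rank-one instance of condition (B): `(m, n, 4ε) = (3, 1, 2)` satisfies `2n + 4ε < m + 2`
(a unitary group in three variables against a hermitian line — the see-saw partner of `U(1,1)`), so Théorème 5
gives `I_ν(Φ) = E(Φ)` under the place hypothesis. [folklore] -/
theorem WeilSiegelWeil.thetaInt_eq_eis_of_three_one {D : SiegelWeilDatum SX} (h : D.WeilSiegelWeil)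
    (hm : D.m = 3) (hn : D.n = 1) (he : D.fourEps = 2) (hp : D.placeHyp) (Φ : SX) :
    D.thetaInt Φ = D.eis Φ :=
  h (by omega) hp Φ

end SiegelWeilDatum

end Literature.NumberTheory.Weil1965
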